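import Literature.Probability.Percolation.TriVoronoiCells
import Literature.Topology.PlaneTopology.RectangleDuality
import HarnessLib

/-!
# Planar duality for site percolation on `δ𝕋` in a chart rectangle, with room

Topic `Literature/Probability/Percolation`; family `crit-perc`. The deterministic half of planar
duality for site percolation on the triangular lattice ("either an open horizontal crossing or a
closed vertical crossing", Bollobás–Riordan, *Percolation* (2006), Ch. 5 Lemma 7 p. 131 for
rhombi, Ch. 7 Lemma 5 p. 169 for discrete domains; Schramm–Smirnov, Ann. Probab. 39 (2011), proof
of Lemma 6.1: "hence there is a dual closed crossing"), for the image `Φ([-a, a] × [-b, b])` of a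
coordinate rectangle under an ARBITRARY homeomorphism `Φ` of the plane, in the form WITH ROOM that
transfer arguments between lattices consume: for every colour class `B` of sites and every mesh
`δ ≤ δ₀(Φ, ν)`,

* `tri_chart_duality_h`: either some `𝕋`-path of sites of `B`, drawn (by `triMeshPoint δ`, read in
  the chart `Φ⁻¹`) inside the `ν`-enlarged rectangle, joins the `ν`-neighbourhood of the left side
  to that of the right side, or some `𝕋`-path of sites of `Bᶜ` inside the same enlarged rectangle
  joins the `ν`-neighbourhoods of the bottom and top sides;
* `tri_chart_duality_v`: the same with the roles of horizontal and vertical exchanged.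

Proof (continuum duality + Voronoi cells, no lattice combinatorics): pull the closed Voronoi
cells (`TriVoronoiCells.lean`) of the sites of `B` back to the chart and let `𝒦` be the part of
their union in the rectangle.  If a connected `C ⊆ 𝒦` meets both vertical sides, the cells of
`B` covering `Φ(C)` contain a `𝕋`-path of sites of `B` (`exists_pathIn_of_subset_triVoronoiCell`:
cells meet only for equal or adjacent sites); otherwise the dual-path theorem for rectangles
(`Literature.Topology.PlaneTopology.exists_path_avoiding_of_not_crossed`: cut-wire theorem +
Janiszewski) gives a path from the bottom to the top side off `𝒦`, which is covered by cells of
sites of `Bᶜ` only, whence a `𝕋`-path of sites of `Bᶜ`.  Every site met is within `0.7 δ` of the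
image rectangle, hence (uniform continuity of `Φ⁻¹` near the compact `Φ([-M, M]²)`,
`exists_chart_room`) inside the `ν`-enlarged rectangle in the chart.  The threshold `δ₀` depends
on `Φ`, `ν` and the bound `M` on `a, b` only.

## References

* B. Bollobás, O. Riordan, *Percolation*, Cambridge University Press (2006), Ch. 5 Lemma 7
  p. 131; Ch. 7 Lemma 5 p. 169.
* O. Schramm, S. Smirnov, *On the scaling limits of planar percolation*, Ann. Probab. 39 (2011)
  1768–1814, §1.3 and proof of Lemma 6.1.

## Mathlib / tree

Mathlib: `IsCompact.uniformContinuousOn_of_continuous`, `Metric.uniformContinuousOn_iff`,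
`IsCompact.cthickening`, `Homeomorph`. Tree: `TriVoronoiCells.lean`, `RectangleDuality.lean`,
`PathIn` (`SitePaths.lean`).
-/

noncomputable section

open Set Metric

namespace Literature.Probability.Percolation

open LatticeModels

/-! ### Two elementary chart facts -/

/-- **Chart room**: for a homeomorphism `Φ` of the plane, a compact `K` and `ν > 0` there is
`ρ > 0` such that every point within `ρ` of `Φ z`, `z ∈ K`, is mapped by `Φ⁻¹` to within `ν` of
`z` (uniform continuity of `Φ⁻¹` on the compact `1`-neighbourhood of `Φ(K)`). [folklore] -/
theorem exists_chart_room (Φ : ℂ ≃ₜ ℂ) {K : Set ℂ} (hK : IsCompact K) {ν : ℝ} (hν : 0 < ν) :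
    ∃ ρ > 0, ∀ z ∈ K, ∀ p : ℂ, dist p (Φ z) ≤ ρ → dist (Φ.symm p) z < ν := by
  have hL : IsCompact (cthickening 1 (Φ '' K)) := (hK.image Φ.continuous).cthickening
  obtain ⟨η, hη, hηu⟩ := Metric.uniformContinuousOn_iff.1
    (hL.uniformContinuousOn_of_continuous Φ.symm.continuous.continuousOn) ν hν
  refine ⟨min (η / 2) 1, lt_min (half_pos hη) one_pos, fun z hz p hp => ?_⟩
  have hzK : Φ z ∈ Φ '' K := mem_image_of_mem Φ hz
  have hpL : p ∈ cthickening 1 (Φ '' K) :=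
    mem_cthickening_of_dist_le p (Φ z) 1 _ hzK (hp.trans (min_le_right _ _))
  have hzL : Φ z ∈ cthickening 1 (Φ '' K) := self_subset_cthickening _ hzK
  have h := hηu p hpL (Φ z) hzL (hp.trans_lt (lt_of_le_of_lt (min_le_left _ _) (half_lt_self hη)))
  rwa [Homeomorph.symm_apply_apply] at h

/-- The swap of the coordinates `x + iy ↦ y + ix` is a homeomorphism of the plane. [folklore] -/
theorem exists_homeomorph_swap : ∃ J : ℂ ≃ₜ ℂ, ∀ z, J z = ⟨z.im, z.re⟩ := by
  have hc : Continuous fun z : ℂ => (⟨z.im, z.re⟩ : ℂ) := by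
    have e : (fun z : ℂ => (⟨z.im, z.re⟩ : ℂ)) = fun z => (z.im : ℂ) + (z.re : ℂ) * Complex.I := by
      funext z; apply Complex.ext <;> simp
    rw [e]; fun_prop
  exact ⟨{ toFun := fun z => ⟨z.im, z.re⟩, invFun := fun z => ⟨z.im, z.re⟩,
           left_inv := fun z => by cases z; rfl, right_inv := fun z => by cases z; rfl,
           continuous_toFun := hc, continuous_invFun := hc }, fun z => rfl⟩

/-! ### Duality in a chart rectangle -/

/-- **Planar duality for site percolation on `δ𝕋` in a chart rectangle (horizontal form), with
room.**  For a homeomorphism `Φ` of the plane, a room `ν > 0` and a size bound `M` there is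
`δ₀ > 0` such that for every mesh `0 < δ ≤ δ₀`, every set `B` of sites and every rectangle
`[-a, a] × [-b, b]` with `0 < a, b ≤ M`: either sites `u, w` with `Re Φ⁻¹(δu) ≤ -a + ν`,
`a - ν ≤ Re Φ⁻¹(δw)` are joined by a `𝕋`-path of sites of `B` all drawn in
`Φ([-a-ν, a+ν] × [-b-ν, b+ν])`, or sites `u, w` with `Im Φ⁻¹(δu) ≤ -b + ν`, `b - ν ≤ Im Φ⁻¹(δw)`
are joined by such a path of sites of `Bᶜ`.
[cite: BollobasRiordan2006, Ch. 7 Lemma 5 p. 169] -/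
theorem tri_chart_duality_h (Φ : ℂ ≃ₜ ℂ) {ν : ℝ} (hν : 0 < ν) (M : ℝ) :
    ∃ δ₀ > 0, ∀ δ : ℝ, 0 < δ → δ ≤ δ₀ → ∀ (B : Set (Site 2)) (a b : ℝ), 0 < a → a ≤ M → 0 < b → b ≤ M →
      (∃ u w : Site 2, (Φ.symm (triMeshPoint δ u)).re ≤ -a + ν ∧ a - ν ≤ (Φ.symm (triMeshPoint δ w)).re ∧
          PathIn triGraph ({v | Φ.symm (triMeshPoint δ v) ∈ Icc (-a - ν) (a + ν) ×ℂ Icc (-b - ν) (b + ν)} ∩ B) u w) ∨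
      (∃ u w : Site 2, (Φ.symm (triMeshPoint δ u)).im ≤ -b + ν ∧ b - ν ≤ (Φ.symm (triMeshPoint δ w)).im ∧
          PathIn triGraph ({v | Φ.symm (triMeshPoint δ v) ∈ Icc (-a - ν) (a + ν) ×ℂ Icc (-b - ν) (b + ν)} ∩ Bᶜ) u w) := by
  obtain ⟨ρ, hρ, hroom⟩ := exists_chart_room Φ (K := Icc (-M) M ×ℂ Icc (-M) M)
    (isCompact_Icc.reProdIm isCompact_Icc) hν
  refine ⟨ρ, hρ, fun δ hδ hδρ B a b ha haM hb hbM => ?_⟩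
  set cell : Site 2 → Set ℂ := fun v => voronoiCell (range (triMeshPoint δ)) (triMeshPoint δ v) with hcell
  set Rect : Set ℂ := Icc (-a) a ×ℂ Icc (-b) b with hRect
  have hRc : IsCompact Rect := isCompact_Icc.reProdIm isCompact_Icc
  have hRK : Rect ⊆ Icc (-M) M ×ℂ Icc (-M) M := fun z hz =>
    ⟨⟨by linarith [hz.1.1], by linarith [hz.1.2]⟩, ⟨by linarith [hz.2.1], by linarith [hz.2.2]⟩⟩
  -- the room: a site whose cell contains `Φ z`, `z ∈ Rect`, is read within `ν` of `z`
  have hnear : ∀ z ∈ Rect, ∀ v : Site 2, Φ z ∈ cell v → dist (Φ.symm (triMeshPoint δ v)) z < ν := by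
    intro z hz v hv
    refine hroom z (hRK hz) _ ?_
    have := dist_le_of_mem_triVoronoiCell hδ hv
    rw [dist_comm] at this
    linarith
  have hbox : ∀ z ∈ Rect, ∀ v : Site 2, Φ z ∈ cell v →
      Φ.symm (triMeshPoint δ v) ∈ Icc (-a - ν) (a + ν) ×ℂ Icc (-b - ν) (b + ν) := by
    intro z hz v hv
    have hd := hnear z hz v hv
    rw [dist_eq_norm] at hd
    have hre := (Complex.abs_re_le_norm (Φ.symm (triMeshPoint δ v) - z)).trans_lt hd
    have him := (Complex.abs_im_le_norm (Φ.symm (triMeshPoint δ v) - z)).trans_lt hd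
    rw [Complex.sub_re, abs_lt] at hre
    rw [Complex.sub_im, abs_lt] at him
    exact ⟨⟨by linarith [hz.1.1], by linarith [hz.1.2]⟩, ⟨by linarith [hz.2.1], by linarith [hz.2.2]⟩⟩
  -- the cells of `B` meeting the image rectangle, and the obstacle
  set F : Set (Site 2) := {v | v ∈ B ∧ (Φ '' Rect ∩ cell v).Nonempty} with hF
  have hFfin : F.Finite :=
    (finite_setOf_inter_triVoronoiCell_nonempty hδ (hRc.image Φ.continuous).isBounded).subset fun v hv => hv.2
  set 𝒦 : Set ℂ := Rect ∩ Φ ⁻¹' (⋃ v ∈ F, cell v) with h𝒦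
  have h𝒦c : IsCompact 𝒦 :=
    hRc.inter_right ((hFfin.isClosed_biUnion fun v _ => isClosed_triVoronoiCell δ v).preimage Φ.continuous)
  by_cases hC : ∃ C ⊆ 𝒦, IsPreconnected C ∧ (∃ z ∈ C, z.re = -a) ∧ (∃ z ∈ C, z.re = a)
  · -- a connected piece of the obstacle joins the vertical sides: a `B`-path
    obtain ⟨C, hC𝒦, hCc, ⟨z₀, hz₀, hz₀re⟩, ⟨z₁, hz₁, hz₁re⟩⟩ := hC
    left
    have hCR : C ⊆ Rect := fun z hz => (hC𝒦 hz).1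
    have hS : IsPreconnected (Φ '' C) := hCc.image Φ Φ.continuous.continuousOn
    have hSb : Bornology.IsBounded (Φ '' C) := (hRc.image Φ.continuous).isBounded.subset (image_mono hCR)
    have hScov : Φ '' C ⊆ ⋃ v ∈ B, cell v := by
      rintro _ ⟨z, hz, rfl⟩
      obtain ⟨v, hv, hzv⟩ := mem_iUnion₂.1 (hC𝒦 hz).2
      exact mem_iUnion₂.2 ⟨v, hv.1, hzv⟩
    obtain ⟨u, w, hu, hw, hpath⟩ := exists_pathIn_of_subset_triVoronoiCell hδ hS hSb hScov
      (mem_image_of_mem Φ hz₀) (mem_image_of_mem Φ hz₁)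
    refine ⟨u, w, ?_, ?_, hpath.mono ?_⟩
    · have hd := hnear z₀ (hCR hz₀) u hu
      rw [dist_eq_norm] at hd
      have hre := (Complex.abs_re_le_norm (Φ.symm (triMeshPoint δ u) - z₀)).trans_lt hd
      rw [Complex.sub_re, abs_lt] at hre
      linarith [hre.2]
    · have hd := hnear z₁ (hCR hz₁) w hw
      rw [dist_eq_norm] at hd
      have hre := (Complex.abs_re_le_norm (Φ.symm (triMeshPoint δ w) - z₁)).trans_lt hd
      rw [Complex.sub_re, abs_lt] at hre
      linarith [hre.1]
    · rintro v ⟨hvB, s, ⟨z, hz, rfl⟩, hsv⟩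
      exact ⟨hbox z (hCR hz) v hsv, hvB⟩
  · -- no such piece: a dual path off the obstacle, covered by cells of `Bᶜ`
    right
    push Not at hC
    obtain ⟨γ, hγc, hγR, hγ0, hγ1, hγ𝒦⟩ :=
      Literature.Topology.PlaneTopology.exists_path_avoiding_of_not_crossed (𝒦 := 𝒦)
        (by linarith : -a < a) (by linarith : -b < b) h𝒦c inter_subset_left
        (fun C hC' hCc h0 h1 => by
          obtain ⟨z, hz, hzre⟩ := h1
          exact hC C hC' hCc h0 z hz hzre)
    set S : Set ℂ := (fun t => Φ (γ t)) '' Icc 0 1 with hSdef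
    have hS : IsPreconnected S := isPreconnected_Icc.image _ (Φ.continuous.comp_continuousOn hγc)
    have hSR : S ⊆ Φ '' Rect := by
      rintro _ ⟨t, ht, rfl⟩
      exact mem_image_of_mem Φ (hγR ht)
    have hSb : Bornology.IsBounded S := (hRc.image Φ.continuous).isBounded.subset hSR
    have hScov : S ⊆ ⋃ v ∈ Bᶜ, cell v := by
      rintro _ ⟨t, ht, rfl⟩
      obtain ⟨v, hv⟩ := exists_mem_triVoronoiCell hδ (Φ (γ t))
      refine mem_iUnion₂.2 ⟨v, fun hvB => hγ𝒦 t ht ⟨hγR ht, ?_⟩, hv⟩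
      exact mem_iUnion₂.2 ⟨v, ⟨hvB, Φ (γ t), mem_image_of_mem Φ (hγR ht), hv⟩, hv⟩
    obtain ⟨u, w, hu, hw, hpath⟩ := exists_pathIn_of_subset_triVoronoiCell hδ hS hSb hScov
      (mem_image_of_mem (fun t => Φ (γ t)) (left_mem_Icc.2 (zero_le_one : (0 : ℝ) ≤ 1)))
      (mem_image_of_mem (fun t => Φ (γ t)) (right_mem_Icc.2 (zero_le_one : (0 : ℝ) ≤ 1)))
    refine ⟨u, w, ?_, ?_, hpath.mono ?_⟩
    · have hd := hnear (γ 0) (hγR (left_mem_Icc.2 zero_le_one)) u hu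
      rw [dist_eq_norm] at hd
      have him := (Complex.abs_im_le_norm (Φ.symm (triMeshPoint δ u) - γ 0)).trans_lt hd
      rw [Complex.sub_im, abs_lt] at him
      linarith [him.2]
    · have hd := hnear (γ 1) (hγR (right_mem_Icc.2 zero_le_one)) w hw
      rw [dist_eq_norm] at hd
      have him := (Complex.abs_im_le_norm (Φ.symm (triMeshPoint δ w) - γ 1)).trans_lt hd
      rw [Complex.sub_im, abs_lt] at him
      linarith [him.1]
    · rintro v ⟨hvB, s, ⟨t, ht, rfl⟩, hsv⟩
      exact ⟨hbox (γ t) (hγR ht) v hsv, hvB⟩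

/-- **Planar duality for site percolation on `δ𝕋` in a chart rectangle (vertical form), with
room**: either a `𝕋`-path of sites of `B` drawn in `Φ([-a-ν, a+ν] × [-b-ν, b+ν])` joins
`{Im Φ⁻¹ ≤ -b + ν}` to `{b - ν ≤ Im Φ⁻¹}`, or such a path of sites of `Bᶜ` joins
`{Re Φ⁻¹ ≤ -a + ν}` to `{a - ν ≤ Re Φ⁻¹}` (the horizontal form for the chart `Φ ∘ swap`).
[cite: BollobasRiordan2006, Ch. 7 Lemma 5 p. 169] -/
theorem tri_chart_duality_v (Φ : ℂ ≃ₜ ℂ) {ν : ℝ} (hν : 0 < ν) (M : ℝ) :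
    ∃ δ₀ > 0, ∀ δ : ℝ, 0 < δ → δ ≤ δ₀ → ∀ (B : Set (Site 2)) (a b : ℝ), 0 < a → a ≤ M → 0 < b → b ≤ M →
      (∃ u w : Site 2, (Φ.symm (triMeshPoint δ u)).im ≤ -b + ν ∧ b - ν ≤ (Φ.symm (triMeshPoint δ w)).im ∧
          PathIn triGraph ({v | Φ.symm (triMeshPoint δ v) ∈ Icc (-a - ν) (a + ν) ×ℂ Icc (-b - ν) (b + ν)} ∩ B) u w) ∨
      (∃ u w : Site 2, (Φ.symm (triMeshPoint δ u)).re ≤ -a + ν ∧ a - ν ≤ (Φ.symm (triMeshPoint δ w)).re ∧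
          PathIn triGraph ({v | Φ.symm (triMeshPoint δ v) ∈ Icc (-a - ν) (a + ν) ×ℂ Icc (-b - ν) (b + ν)} ∩ Bᶜ) u w) := by
  obtain ⟨J, hJ⟩ := exists_homeomorph_swap
  have hJsymm : ∀ z, J.symm z = ⟨z.im, z.re⟩ := fun z => by
    rw [Homeomorph.symm_apply_eq, hJ]
  obtain ⟨δ₀, hδ₀, h⟩ := tri_chart_duality_h (J.trans Φ) hν M
  refine ⟨δ₀, hδ₀, fun δ hδ hδ' B a b ha haM hb hbM => ?_⟩
  have hsymm : ∀ p : ℂ, (J.trans Φ).symm p = ⟨(Φ.symm p).im, (Φ.symm p).re⟩ := fun p =>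
    hJsymm (Φ.symm p)
  have hset : {v : Site 2 | (J.trans Φ).symm (triMeshPoint δ v) ∈ Icc (-b - ν) (b + ν) ×ℂ Icc (-a - ν) (a + ν)} =
      {v | Φ.symm (triMeshPoint δ v) ∈ Icc (-a - ν) (a + ν) ×ℂ Icc (-b - ν) (b + ν)} := by
    ext v
    simp only [mem_setOf_eq, hsymm, Complex.mem_reProdIm]
    exact and_comm
  rcases h δ hδ hδ' B b a hb hbM ha haM with ⟨u, w, hu, hw, hp⟩ | ⟨u, w, hu, hw, hp⟩
  · left
    refine ⟨u, w, by simpa only [hsymm] using hu, by simpa only [hsymm] using hw, ?_⟩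
    rwa [hset] at hp
  · right
    refine ⟨u, w, by simpa only [hsymm] using hu, by simpa only [hsymm] using hw, ?_⟩
    rwa [hset] at hp

end Literature.Probability.Percolation

end
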